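import Literature.NumberTheory.CubicFields.DeloneFaddeevIrreducible
import Mathlib.FieldTheory.IsAlgClosed.Basic
import Mathlib.FieldTheory.Separable
import Mathlib.Analysis.Complex.Polynomial.Basic
import HarnessLib

/-!
# Irreducible binary cubic forms are nondegenerate: `Disc ≠ 0`

Topic `Literature/NumberTheory/CubicFields`, a complement to `DeloneFaddeevIrreducible.lean`
(`BinaryCubic.IsIrreducible`, `RingOfForm.isDomain_iff_isIrreducible`).

Bhargava–Taniguchi–Thorne 2023, §2.1: "Note that if `R` is an integral domain, then it is
automatically nondegenerate (i.e., `Disc(R) ≠ 0`)." With Thm 2.1 (`R(f)` is a domain iff `f` is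
irreducible, `Disc R(f) = Disc f`) this is the statement that **an integral binary cubic form
irreducible over `ℚ` has nonzero discriminant**, proved here from the separability of
irreducible polynomials in characteristic `0`:

* `BinaryCubic.disc_ne_zero_of_isIrreducible` — `f` irreducible ⇒ `Disc f ≠ 0`;
* `RingOfForm.disc_ne_zero_of_isDomain` — `R(f)` an integral domain ⇒ `Disc f ≠ 0`
  (equivalently `Disc R(f) ≠ 0`, `discr_basis_ne_zero_of_isDomain`).

## References

* M. Bhargava, T. Taniguchi, F. Thorne, *Improved error estimates for the Davenport–Heilbronn
  theorems*, Math. Ann. 389 (2024) = arXiv:2107.12819, §2.1 [BhargavaTaniguchiThorne2023].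
-/

namespace Literature.NumberTheory.CubicFields

open Polynomial

namespace BinaryCubic

/-- `Disc f`, pushed to `ℚ`, is the discriminant of the rational cubic `f(u, 1)`. [folklore] -/
theorem ratCubic_discr (f : BinaryCubic ℤ) : (f.map (Int.castRingHom ℚ)).toCubic.discr = (f.disc : ℚ) := by
  rw [disc, toCubic_map, Cubic.discr, Cubic.discr]
  simp [Cubic.map]

/-- **An irreducible integral binary cubic form is nondegenerate**: `Disc f ≠ 0`. Proof: `f(u,1)`
is irreducible over `ℚ`, hence separable (characteristic `0`), so its three complex roots are
distinct and the discriminant of the cubic is nonzero (BTT 2023, §2.1: an integral domain is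
automatically nondegenerate). [cite: BhargavaTaniguchiThorne2023, §2.1 (integral domain ⇒ nondegenerate, Disc ≠ 0)] -/
theorem disc_ne_zero_of_isIrreducible {f : BinaryCubic ℤ} (hf : f.IsIrreducible) : f.disc ≠ 0 := by
  obtain ⟨ha, hirr⟩ := hf
  -- the rational cubic and its complex roots
  set P : Cubic ℚ := (f.map (Int.castRingHom ℚ)).toCubic with hP
  have haP : P.a ≠ 0 := by simpa [hP] using ha
  have hsplit : (P.toPoly.map (algebraMap ℚ ℂ)).Splits := IsAlgClosed.splits _
  have hsep : (P.toPoly.map (algebraMap ℚ ℂ)).Separable := (Irreducible.separable hirr).map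
  have hnodup : (Cubic.map (algebraMap ℚ ℂ) P).roots.Nodup := by
    rw [Cubic.map_roots]
    exact nodup_roots hsep
  have hdisc : P.discr ≠ 0 := (Cubic.discr_ne_zero_iff_roots_nodup haP hsplit).mpr hnodup
  rw [hP, ratCubic_discr] at hdisc
  exact_mod_cast hdisc

/-- Equivalently: a degenerate form (`Disc f = 0`) is reducible. [folklore] -/
theorem not_isIrreducible_of_disc_eq_zero {f : BinaryCubic ℤ} (h : f.disc = 0) : ¬ f.IsIrreducible :=
  fun hf => disc_ne_zero_of_isIrreducible hf h

end BinaryCubic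

namespace RingOfForm

/-- **An integral domain `R(f)` is nondegenerate** (BTT 2023, §2.1): `Disc f ≠ 0`. [cite: BhargavaTaniguchiThorne2023, §2.1 (if R is an integral domain then Disc(R) ≠ 0)] -/
theorem disc_ne_zero_of_isDomain (f : BinaryCubic ℤ) [IsDomain (RingOfForm f)] : f.disc ≠ 0 :=
  BinaryCubic.disc_ne_zero_of_isIrreducible (isIrreducible_of_isDomain f)

/-- … i.e. `Disc R(f) ≠ 0` for the trace-form discriminant of the cubic ring. [folklore] -/
theorem discr_basis_ne_zero_of_isDomain (f : BinaryCubic ℤ) [IsDomain (RingOfForm f)] :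
    Algebra.discr ℤ (basis f) ≠ 0 := by
  rw [discr_basis_eq_disc]
  exact disc_ne_zero_of_isDomain f

end RingOfForm

end Literature.NumberTheory.CubicFields
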